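import Mathlib
import Summits.CriticalPhenomena.CardyFormulaZ2.Theorems.CardyWhiteToColouredDriftBoundStubWhiteWindow

/-!
# Plackett/Piterbarg drift identity for the noise heat flow, part 2: the summable envelope

Helper file for crux item `DriftBound` (stmt-CriticalPhenomena-4596) of route `CardyWhiteToColoured`
(`CardyFormulaZ2`), line `registered` (`Cruxes/DriftBound/Lines/birth.lean`, skeleton v3.2, lead c3),
towards the open stub `stub_window`, sub-goal `pl_envelope` of the exact drift identity.

The fields of the line are `ℓ¹`-linear Gaussian series `X_i(ξ) = ∑' e, G i e ξ_e` over i.i.d.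
standard Gaussians `ξ_e` (`γ∞ = ⨂_e N(0,1)`, Mathlib `Measure.infinitePi`), with coefficients
dominated by a summable envelope `u ≥ 0`: `|G i e| ≤ u e`. This file proves the two facts about the
envelope that every later step uses (dominated termwise differentiation, differentiation under the
integral, interchange of `∫` and `∑'`):

* almost surely `∑_e u_e |ξ_e| < ∞` (its expectation is `E|N(0,1)| ∑_e u_e < ∞`);
* `ξ ↦ ∑' e, u_e |ξ_e|` is integrable against `γ∞`.

References: D. Beliaev, S. Muirhead, A. Rivera, Ann. Probab. 48 (2020), §2.2; S. Muirhead,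
H. Vanneuville, Ann. Inst. H. Poincaré Probab. Stat. 56 (2020), §2.1 (discretised white noise).
-/

noncomputable section

namespace Summit.CriticalPhenomena.CardyFormulaZ2.Cruxes.DriftBound.Birth

open MeasureTheory ProbabilityTheory Filter Topology Set
open scoped ENNReal NNReal

variable {ι : Type*} [Countable ι]

/-- The enveloping series `Y(ξ) = ∑' e, ‖u_e ξ_e‖ₑ` has finite expectation
`∑_e u_e · E‖N(0,1)‖` when `u ≥ 0` is summable. -/
theorem pl_lintegral_envelope_ne_top {u : ι → ℝ} (hu : Summable u) (hu0 : ∀ e, 0 ≤ u e) :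
    ∫⁻ ξ, ∑' e, ‖u e * ξ e‖ₑ ∂Measure.infinitePi (fun _ : ι => gaussianReal 0 1) ≠ ⊤ := by
  have hmeas : ∀ e : ι, Measurable fun ξ : ι → ℝ => ‖u e * ξ e‖ₑ := fun e =>
    (measurable_const.mul (measurable_pi_apply e)).enorm
  rw [lintegral_tsum fun e => (hmeas e).aemeasurable]
  have hle : ∀ e : ι, ∫⁻ ξ, ‖u e * ξ e‖ₑ ∂Measure.infinitePi (fun _ : ι => gaussianReal 0 1) =
      ENNReal.ofReal (u e) * ∫⁻ t : ℝ, ‖t‖ₑ ∂(gaussianReal 0 1) := by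
    intro e
    have : (fun ξ : ι → ℝ => ‖u e * ξ e‖ₑ) = fun ξ => ENNReal.ofReal (u e) * ‖ξ e‖ₑ := by
      funext ξ; rw [enorm_mul, Real.enorm_eq_ofReal (hu0 e)]
    rw [this, lintegral_const_mul _ (measurable_pi_apply e).enorm,
      (measurePreserving_eval_infinitePi (fun _ : ι => gaussianReal 0 1) e).lintegral_comp measurable_enorm]
  simp_rw [hle]
  rw [ENNReal.tsum_mul_right]
  refine ENNReal.mul_ne_top ?_ lintegral_enorm_gaussianReal_ne_top
  rw [← ENNReal.ofReal_tsum_of_nonneg hu0 hu]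
  exact ENNReal.ofReal_ne_top

/-- **Almost surely the envelope converges against the noise**: `∑_e u_e |ξ_e| < ∞` a.s. -/
theorem pl_ae_summable_envelope {u : ι → ℝ} (hu : Summable u) (hu0 : ∀ e, 0 ≤ u e) :
    ∀ᵐ ξ ∂Measure.infinitePi (fun _ : ι => gaussianReal 0 1), Summable fun e => u e * |ξ e| := by
  have hmeas : ∀ e : ι, Measurable fun ξ : ι → ℝ => ‖u e * ξ e‖ₑ := fun e =>
    (measurable_const.mul (measurable_pi_apply e)).enorm
  filter_upwards [ae_lt_top (Measurable.tsum hmeas) (pl_lintegral_envelope_ne_top hu hu0)] with ξ hξ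
  have h1 : (∑' e : ι, ((‖u e * ξ e‖₊ : ℝ≥0) : ℝ≥0∞)) ≠ ⊤ := hξ.ne
  have h2 := NNReal.summable_coe.2 (ENNReal.tsum_coe_ne_top_iff_summable.1 h1)
  refine h2.congr fun e => ?_
  simp only [coe_nnnorm, norm_mul, Real.norm_eq_abs, abs_of_nonneg (hu0 e)]

/-- The real envelope series is measurable in the noise. -/
theorem pl_measurable_envelope (u : ι → ℝ) :
    Measurable fun ξ : ι → ℝ => ∑' e, u e * |ξ e| :=
  Measurable.tsum fun e => measurable_const.mul (measurable_pi_apply e).abs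

/-- **The envelope series is integrable**: `ξ ↦ ∑' e, u_e |ξ_e| ∈ L¹(γ∞)`. -/
theorem pl_integrable_envelope {u : ι → ℝ} (hu : Summable u) (hu0 : ∀ e, 0 ≤ u e) :
    Integrable (fun ξ : ι → ℝ => ∑' e, u e * |ξ e|) (Measure.infinitePi fun _ : ι => gaussianReal 0 1) := by
  refine ⟨(pl_measurable_envelope u).aestronglyMeasurable, ?_⟩
  refine (hasFiniteIntegral_iff_enorm.2 ?_)
  refine lt_of_le_of_lt (lintegral_mono fun ξ => ?_) (pl_lintegral_envelope_ne_top hu hu0).lt_top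
  -- `‖∑' u_e |ξ_e|‖ₑ ≤ ∑' ‖u_e ξ_e‖ₑ`
  have hnn : ∀ e, 0 ≤ u e * |ξ e| := fun e => mul_nonneg (hu0 e) (abs_nonneg _)
  by_cases hs : Summable fun e => u e * |ξ e|
  · rw [Real.enorm_eq_ofReal (tsum_nonneg hnn), ENNReal.ofReal_tsum_of_nonneg hnn hs]
    refine ENNReal.tsum_le_tsum fun e => ?_
    rw [enorm_mul, Real.enorm_eq_ofReal (hu0 e), Real.enorm_eq_ofReal_abs]
    rw [ENNReal.ofReal_mul (hu0 e)]
  · rw [tsum_eq_zero_of_not_summable hs]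
    simp

/-- **The summable envelope (registered form)**: for a summable `u ≥ 0` on a countable index,
almost surely `∑_e u_e |ξ_e| < ∞` under `γ∞ = ⨂_e N(0,1)`, and `ξ ↦ ∑' e, u_e |ξ_e|` is
integrable. Fully qualified, notation-free statement of `pl_ae_summable_envelope` and
`pl_integrable_envelope`, registered as a sub-goal stub of the crux item. -/
theorem pl_envelope : ∀ {ι : Type} [Countable ι] (u : ι → ℝ), Summable u → (∀ e : ι, 0 ≤ u e) → Filter.Eventually (fun ξ : ι → ℝ => Summable (fun e : ι => u e * |ξ e|)) (MeasureTheory.ae (MeasureTheory.Measure.infinitePi (fun _ : ι => ProbabilityTheory.gaussianReal 0 1))) ∧ MeasureTheory.Integrable (fun ξ : ι → ℝ => ∑' e : ι, u e * |ξ e|) (MeasureTheory.Measure.infinitePi (fun _ : ι => ProbabilityTheory.gaussianReal 0 1)) := by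
  intro ι _ u hu hu0
  exact ⟨pl_ae_summable_envelope hu hu0, pl_integrable_envelope hu hu0⟩

end Summit.CriticalPhenomena.CardyFormulaZ2.Cruxes.DriftBound.Birth

end
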